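import Summits.QuantumFields.YangMills.Theorems.AlphaInputsT3ACv3AbelianSmall
import Summits.QuantumFields.YangMills.Theorems.AlphaInputsT3ACv3LinAvgIterFluxRigid
import HarnessLib

/-!
# `AlphaInputsT3ACv3AbelianCurlIter` — THE EXACT CURL OF THE ITERATED (0.4) LINEAR AVERAGE OF A REAL ONE-FORM: around a coarse plaquette of `T^{(s)}`
# `curl (linAvgIter s a)(y; μ, ν) = (L^s)^{−d} · Σ_{x ∈ B^s(y)} Σ_{a′,b′ < L^s} curl a (x + a′e_μ + b′e_ν; μ, ν)` — print's RIGID block sum of [Balaban1985UV3] (69),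
# for the REAL iterate `AbelianEML.linAvgIter` of the lane's abelian (0.4) calculus — cell `ym3-torus`, width seat `ym-ust-19936-w4` (g5)

WHY (cell `ym3-torus` bus 2026-08-28: LEAD ★w1-19936 g3 card v1.2 §residue (E2)∕(U2); ★w5-19936 g4 ✓`…v3ChargedGlueXs` displays the kinematic row `hU2`
«the enlarged-region profile is (67)-large in RECORDING currency, `profE ∈ AlphaInputsT3AC.large67RecSet`»).  The recording currency reads the `j`-fold SYMMETRIC
average `(blockAvg ℰp)^j` ([Balaban1987RG1] (0.4) with `exp[mean log]` on `SU(2)`); on the lane's abelian test configurations `gexpAt a` it is again abelian, with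
the iterated LINEAR average `linAvgIter j a` (✓ `AbelianEML.iter_blockAvg_gexpAt_region`), so the recorded plaquette variable is `gexp (curl (linAvgIter j a))` and a
LOWER bound on it needs the curl EXACTLY.  The tree has the bound `abs_curlAt_linAvgIter_le_region` (and route `SmallFieldWidening` takes the exact linear representation
as a HYPOTHESIS), and it has the exact identity for the MATRIX-valued linearised average `BlockAveragingEMLLinearised.linAvg` (★w6-19936 g2's ✓
`LinAvgIterFluxRigid.curl_iterLinAvg_eq_rigidFlux_offsets`).  THIS FILE transports the latter to the real iterate: §1 the real (0.4) calculus of `…v3AbelianEML`∕`…v3AbelianCurl`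
(`wsum`, `linAvg04`) IS the linearised average of `BlockAveragingEMLLinearised` (`walkSum`, `linAvg`) read on scalar multiples `b ↦ a_b·M` of a fixed matrix (`walkSum_walk_ofReal_smul`,
`linAvg04_eq_mean_three`, ★ `linAvg_ofReal_smul`); §2 ★★ `curlAt_linAvgIter_eq_blockSum` — the exact rigid block sum, in the offset letters `fibreSite`∕`runSite` of (69)_sym
(`…SymAvgBlockSum69`), by reading ★w6's rigidity on the family `s ↦ (linAvgIter s a)·1` in `M₁(ℂ)`.
HONEST FRAMING.  Abelian lattice bookkeeping (first order is exact here); no estimate of Bałaban's is asserted; def-free; count-neutral helper toward R3 2′χ (`HistoryTailL`, item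
19936 — NOT proved here); registry untouched (J r4).  YM₃ on T³ is rung R3 of the programme (finite-torus SU(2)), not T⁴, not the continuum, not the Clay problem; no gap claimed.

References: T. Bałaban, Commun. Math. Phys. 109 (1987) 249–301 [Balaban1987RG1] ((0.4), (0.11) p.253); CMP 98 (1985) 17–51 [Balaban1985Averaging] ((9) p.19, (14) p.19,
(124)–(125) p.36); CMP 102 (1985) 255–275 [Balaban1985UV3] ((69) p.273).
-/

set_option autoImplicit false

noncomputable section

open scoped BigOperators

namespace Summit.QuantumFields.YangMills.Theorems.AbelianEML

open Finset
open Literature.MathematicalPhysics.QuantumFieldTheory.Balaban1983to89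
open Literature.MathematicalPhysics.QuantumFieldTheory.Balaban1983to89.T4Continuum
open Literature.MathematicalPhysics.QuantumFieldTheory.Balaban1983to89.BlockAveraging (off Idx)
open Literature.MathematicalPhysics.QuantumFieldTheory.Balaban1983to89.BlockAveragingEMLLinearised (walkSum walkSum_nil walkSum_cons linAvg linAvg_def)
open Literature.MathematicalPhysics.QuantumFieldTheory.Balaban1983to89.LatticeFieldCalculus (runSite runSite_zero runSite_succ)
open Literature.MathematicalPhysics.QuantumFieldTheory.Balaban1985CMP102.Setting
open Summit.QuantumFields.YangMills.Theorems.LinAvgIterFluxRigid (curl_iterLinAvg_eq_rigidFlux_offsets)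

variable {P : Params} {j : ℕ} {n : Type*}

/-! ## §1 The real (0.4) calculus is the linearised (0.4) average read on scalar multiples of a fixed matrix -/

/-- Scalar multiples are additive in the real coefficient. [folklore] -/
theorem ofReal_add_smul (s t : ℝ) (M : Matrix n n ℂ) : (((s + t : ℝ)) : ℂ) • M = ((s : ℝ) : ℂ) • M + ((t : ℝ) : ℂ) • M := by
  rw [Complex.ofReal_add, add_smul]

/-- Scalar multiples are odd in the real coefficient. [folklore] -/
theorem ofReal_neg_smul (t : ℝ) (M : Matrix n n ℂ) : (((-t : ℝ)) : ℂ) • M = -(((t : ℝ) : ℂ) • M) := by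
  rw [Complex.ofReal_neg, neg_smul]

/-- **THE LINEAR HOLONOMY OF `BlockAveragingEMLLinearised` READ ON `b ↦ a_b·M` IS `(wsum a)·M`**: the signed sum of the bond field `b ↦ a_b·M` along the walk spelled by a
word is the abelian walk sum of `…v3AbelianEML` times `M`. [cite: Balaban1984PropagatorsI, (1.8) p.19] -/
theorem walkSum_walk_ofReal_smul (M : Matrix n n ℂ) (a : PBond P j → ℝ) : ∀ (w : List (Letter P.d)) (x : Site P j),
    walkSum (fun b : PBond P j => ((a b : ℝ) : ℂ) • M) (walk x w) = ((wsum a x w : ℝ) : ℂ) • M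
  | [], x => by simp [walk, walkSum_nil]
  | (μ, true) :: w, x => by
    simp only [walk, walkSum_cons, wsum_cons_true]
    rw [walkSum_walk_ofReal_smul M a w (x.shift μ), ofReal_add_smul]
    simp
  | (μ, false) :: w, x => by
    simp only [walk, walkSum_cons, wsum_cons_false]
    rw [walkSum_walk_ofReal_smul M a w (x.unshift μ), ofReal_add_smul, ofReal_neg_smul]
    simp

/-- **THE (0.4) LINEAR AVERAGE AS THE MEAN OF «STAIRCASE + SEGMENT − STAIRCASE»**: `linAvg04 a c = |I|⁻¹ Σ_{(r,σ,σ′)} [a(Γ^σ_{y→x}) + a([x,x′]) − a(Γ^{σ′}_{y′→x′})]` — the axial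
sums of `loopSum_eq` cancel against the axial factor. [cite: Balaban1987RG1, (0.4) p.253] -/
theorem linAvg04_eq_mean_three (a : PBond P j → ℝ) (c : PBond P (j + 1)) :
    linAvg04 a c = (Fintype.card (Idx P) : ℝ)⁻¹ *
      ∑ i : Idx P, (stairSum a c.src (off i.1) i.2.1 + segSum a c.src (off i.1) c.dir - stairSum a c.tgt (off i.1) i.2.2) := by
  unfold linAvg04
  have hI : (Fintype.card (Idx P) : ℝ) ≠ 0 := Nat.cast_ne_zero.mpr Fintype.card_pos.ne'
  simp_rw [loopSum_eq]
  rw [Finset.sum_sub_distrib, Finset.sum_const, Finset.card_univ, nsmul_eq_mul]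
  field_simp
  ring

/-- **★ THE LINEARISED (0.4) AVERAGE OF `b ↦ a_b·M` IS `(linAvg04 a)·M`**: `BlockAveragingEMLLinearised.linAvg` (the first-order term of the (0.4)∕`exp[mean log]` average, ✓
`norm_avgFun_sub_one_sub_linAvg_le`) and the lane's real average `AbelianEML.linAvg04` (the EXACT exponent of the (0.4) average of an abelian configuration, ✓ `avgFun_gexpAt`)
are one operator. [cite: Balaban1985Averaging, (124)–(125) p.36; Balaban1987RG1, (0.4) p.253] -/
theorem linAvg_ofReal_smul (M : Matrix n n ℂ) (a : PBond P j → ℝ) (c : PBond P (j + 1)) :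
    linAvg (fun b : PBond P j => ((a b : ℝ) : ℂ) • M) c = ((linAvg04 a c : ℝ) : ℂ) • M := by
  rw [linAvg_def, linAvg04_eq_mean_three]
  simp_rw [walkSum_walk_ofReal_smul, walkEnd_stairWord_offPt]
  have hterm : ∀ i : Idx P,
      ((wsum a (emb c.src) (stairWord i.2.1 (off i.1)) : ℝ) : ℂ) • M + ((wsum a (offPt c.src (off i.1)) (List.replicate P.L (c.dir, true)) : ℝ) : ℂ) • M -
        ((wsum a (emb c.tgt) (stairWord i.2.2 (off i.1)) : ℝ) : ℂ) • M =
      ((stairSum a c.src (off i.1) i.2.1 + segSum a c.src (off i.1) c.dir - stairSum a c.tgt (off i.1) i.2.2 : ℝ) : ℂ) • M := by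
    intro i
    rw [Complex.ofReal_sub, Complex.ofReal_add, sub_smul, add_smul]
    rfl
  simp_rw [hterm]
  rw [← Finset.sum_smul, ← Complex.ofReal_sum, smul_smul, Complex.ofReal_mul, Complex.ofReal_inv, Complex.ofReal_natCast]

/-! ## §2 The exact curl of the iterated real average: print's rigid block sum -/

/-- Two real multiples of a nonzero matrix agree only if the coefficients do. [folklore] -/
theorem ofReal_smul_injective {M : Matrix n n ℂ} (hM : M ≠ 0) {s t : ℝ} (h : ((s : ℝ) : ℂ) • M = ((t : ℝ) : ℂ) • M) : s = t := by
  have h' : (((s : ℝ) : ℂ) - ((t : ℝ) : ℂ)) • M = 0 := by rw [sub_smul, h, sub_self]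
  rcases smul_eq_zero.mp h' with h0 | h0
  · exact_mod_cast sub_eq_zero.mp h0
  · exact absurd h0 hM

/-- **★★ THE CURL OF THE ITERATED (0.4) LINEAR AVERAGE IS THE RIGID BLOCK SUM OF THE FINE CURLS**: for every real one-form `a` on the finest torus, every level `s` in the
standing range (`s ≤ m + K`), every site `y` of `T^{(s)}` and directions `μ, ν`:
`curl (linAvgIter s a)(y; μ, ν) = ((L^s)^d)⁻¹ · Σ_{r ∈ {0,…,L^s−1}^d} Σ_{a′ < L^s} Σ_{b′ < L^s} curl a (x_r + a′e_μ + b′e_ν; μ, ν)`, `x_r = fibreSite 0 s y r` the fine site of offset `r`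
over `y` — EXACTLY print's rigid sum «`Σ_{x∈B^j(x₀)} L^{−3j} Σ_{p⊂(p′)_x}`» of (69), with no remainder (abelian).  ★w6's matrix rigidity `curl_iterLinAvg_eq_rigidFlux_offsets` read on
the family `s ↦ (linAvgIter s a)·1` in `M₁(ℂ)` through §1. [cite: Balaban1985UV3, (69) p.273; Balaban1985Averaging, (14) p.19; Balaban1987RG1, (0.4)+(0.11) p.253] -/
theorem curlAt_linAvgIter_eq_blockSum {s : ℕ} (hs : s ≤ P.m + P.K) (a : PBond P 0 → ℝ) (y : Site P s) (μ ν : Fin P.d) :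
    curlAt (linAvgIter s a) y μ ν =
      (((P.L : ℝ) ^ s) ^ P.d)⁻¹ *
        ∑ r : Fin P.d → Fin (P.L ^ s), ∑ a' ∈ range (P.L ^ s), ∑ b' ∈ range (P.L ^ s),
          curlAt a (runSite (runSite (Site.fibreSite 0 s y r) μ a') ν b') μ ν := by
  -- the matrix family `Q i Y = Q₁^i Y` of ★w6's rigidity, by recursion
  let Q : (i : ℕ) → (PBond P 0 → Matrix (Fin 1) (Fin 1) ℂ) → PBond P i → Matrix (Fin 1) (Fin 1) ℂ :=
    fun i => Nat.rec (motive := fun i => (PBond P 0 → Matrix (Fin 1) (Fin 1) ℂ) → PBond P i → Matrix (Fin 1) (Fin 1) ℂ)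
      (fun Y => Y) (fun i q Y c => linAvg (q Y) c) i
  have hQ0 : ∀ Y, Q 0 Y = Y := fun Y => rfl
  have hQs : ∀ (i : ℕ) (Y : PBond P 0 → Matrix (Fin 1) (Fin 1) ℂ) (c : PBond P (i + 1)), Q (i + 1) Y c = linAvg (Q i Y) c := fun i Y c => rfl
  -- on `b ↦ a_b·1` the family is `(linAvgIter i a)·1`
  have hQa : ∀ (i : ℕ) (c : PBond P i), Q i (fun b => ((a b : ℝ) : ℂ) • (1 : Matrix (Fin 1) (Fin 1) ℂ)) c =
      ((linAvgIter i a c : ℝ) : ℂ) • (1 : Matrix (Fin 1) (Fin 1) ℂ) := by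
    intro i
    induction i with
    | zero => intro c; rfl
    | succ i ih =>
      intro c
      rw [hQs, linAvgIter_succ]
      have hfun : Q i (fun b => ((a b : ℝ) : ℂ) • (1 : Matrix (Fin 1) (Fin 1) ℂ)) =
          fun b => ((linAvgIter i a b : ℝ) : ℂ) • (1 : Matrix (Fin 1) (Fin 1) ℂ) := funext ih
      rw [hfun, linAvg_ofReal_smul]
  -- ★w6's rigidity on this family
  have hrig := curl_iterLinAvg_eq_rigidFlux_offsets Q hQ0 hQs hs (fun b => ((a b : ℝ) : ℂ) • (1 : Matrix (Fin 1) (Fin 1) ℂ)) y μ ν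
  rw [hQa, hQa, hQa, hQa] at hrig
  -- `runSite x μ 1 = x + e_μ` (the tree's `Prop7LineAvgRightInverse.runSite_one`, not in this import cone)
  have hone : ∀ (x : Site P 0) (κ : Fin P.d), runSite x κ 1 = x.shift κ := fun x κ => by
    rw [show (1 : ℕ) = 0 + 1 from rfl, runSite_succ, runSite_zero]
  simp only [hone] at hrig
  -- both sides as real multiples of `1`
  have hL : ∀ (z : Site P s), ((linAvgIter s a ⟨z, μ⟩ : ℝ) : ℂ) • (1 : Matrix (Fin 1) (Fin 1) ℂ) + ((linAvgIter s a ⟨z.shift μ, ν⟩ : ℝ) : ℂ) • 1 -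
      ((linAvgIter s a ⟨z.shift ν, μ⟩ : ℝ) : ℂ) • 1 - ((linAvgIter s a ⟨z, ν⟩ : ℝ) : ℂ) • 1 =
      ((curlAt (linAvgIter s a) z μ ν : ℝ) : ℂ) • (1 : Matrix (Fin 1) (Fin 1) ℂ) := by
    intro z
    rw [curlAt, Complex.ofReal_sub, Complex.ofReal_sub, Complex.ofReal_add, sub_smul, sub_smul, add_smul]
  have hR : ∀ (z : Site P 0), ((a ⟨z, μ⟩ : ℝ) : ℂ) • (1 : Matrix (Fin 1) (Fin 1) ℂ) + ((a ⟨z.shift μ, ν⟩ : ℝ) : ℂ) • 1 -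
      ((a ⟨z.shift ν, μ⟩ : ℝ) : ℂ) • 1 - ((a ⟨z, ν⟩ : ℝ) : ℂ) • 1 =
      ((curlAt a z μ ν : ℝ) : ℂ) • (1 : Matrix (Fin 1) (Fin 1) ℂ) := by
    intro z
    rw [curlAt, Complex.ofReal_sub, Complex.ofReal_sub, Complex.ofReal_add, sub_smul, sub_smul, add_smul]
  rw [hL] at hrig
  simp_rw [hR, ← Finset.sum_smul, ← Complex.ofReal_sum] at hrig
  rw [real_smul_ofReal_smul, smul_smul, ← Complex.ofReal_natCast, ← Complex.ofReal_pow, ← Complex.ofReal_mul] at hrig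
  have key := ofReal_smul_injective (one_ne_zero) hrig
  rw [key]
  have hL0 : (P.L : ℝ) ≠ 0 := Nat.cast_ne_zero.mpr P.L_pos.ne'
  have hLs : (P.L : ℝ) ^ s ≠ 0 := pow_ne_zero _ hL0
  have hLsd : ((P.L : ℝ) ^ s) ^ P.d ≠ 0 := pow_ne_zero _ hLs
  field_simp

end Summit.QuantumFields.YangMills.Theorems.AbelianEML

end
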